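import Literature.AlgebraicGeometry.Hyperkaehler.K3HilbertTypeTranscendentalSignature
import Literature.AlgebraicGeometry.Motives.HodgeStructureK3TypeSignature
import HarnessLib

/-!
# The transcendental signature fact for `K3^[n]`-type varieties REDUCED to `h^{2,0}(T) = 1`
# (Huybrechts 1999 §1.9 / Beauville 1983 Thm. 5, Hodge-theoretic half) — PROVED

Family `hodge`, layer `Literature/AlgebraicGeometry/Hyperkaehler`. Theorems only (no definition, no named
fact, no instance). Companion of `Hyperkaehler/K3HilbertTypeTranscendentalSignature` (the named fact
`Huybrechts1999_k3HilbertType_transcendentalPart_signature`, W2-HK of the cell `hodge-nonav`): that file's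
docstring records the discharge road «(1) `h^{2,0} = 1` for the transcendental part … (2) the linear algebra
"polarized weight-2 `ℚ`-Hodge structure with `h^{2,0} = 1` ⇒ `-Q` has an orthogonal `ℚ`-basis of signature
`(2, r - 2)`"». Step (2) is now a tree theorem
(`Motives.HodgeStructure.Polarization.exists_basis_neg_form_of_isOfK3Type`, file
`Motives/HodgeStructureK3TypeSignature`: Hodge–Riemann II on `T^{2,0} ⊕ T^{0,2}` and on `T^{1,1}`, a
dimension count, and van Geemen's §5.2 orthogonal family); this file performs the reduction on the cell's
carriers, so that (1) is the ONLY remaining input of the fact.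

## What is proved

* `….piece_eq_bot_of_neg` — the Hodge pieces `T^{p,q}` of a presentation `(T, H, P, j)` of the
  transcendental part (`IsTranscendentalPartHK`) vanish for `p < 0` or `q < 0`: `j` is injective, `j_ℂ` maps
  `T^{p,q}` into `H²_B(X)^{p,q}` (`Hom.map_piece_le`), and the pieces of the Hodge structure of a Hodge
  model vanish there (`F^r H² = 0` for `r > 2`, `HodgeModel.ratF_eq_bot`).
* `….finite_of_isTranscendentalPartHK` — `dim_ℚ T < ∞` (`T ↪ H²(X(ℂ); ℚ)`, `X(ℂ)` a compact manifold).
* `….isOfK3Type_of_hodgeNumber_two_zero` — `h^{2,0}(T) = 1 ⇒ (T, H)` is of K3 type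
  (`HodgeStructure.IsOfK3Type`).
* **`….of_hodgeNumber_two_zero_eq_one`** — the REDUCTION: if every presentation of the transcendental
  part of a smooth projective `K3^[n]`-type `X` (`n ≥ 2`) has `h^{2,0}(T) = 1`, then
  `Huybrechts1999_k3HilbertType_transcendentalPart_signature` holds.

## What is NOT here (the remaining, geometric, input — recorded)

`h^{2,0}(T) = 1` for every presentation: `H^{2,0}(X) = ℂσ` (`IsOfK3HilbertType` is deformation
equivalence to `S^[n]`; Hodge numbers of `S^[n]`, Göttsche; invariance under deformation) AND
`σ ∈ j(T) ⊗ ℂ`, i.e. `b(σ, NS(X)) = 0` — the type-compatibility of the Fujiki form (`b ∝ q_X`, Beauville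
1983 Thm. 5, Huybrechts 1999 §1.9 "with respect to this quadratic form `H^{1,1}(X)` is orthogonal to
`H^{2,0}(X) ⊕ H^{0,2}(X)`"; the tree's `IsFujikiForm` pins `b` only through the Fujiki relation).

## References

* [Huybrechts1999] D. Huybrechts, Compact hyperkähler manifolds: basic results, Invent. Math. 135 (1999)
  63–113 (arXiv alg-geom/9705025), §1.9 (arXiv p0004 L110 – p0005 L38).
* [Beauville1983] A. Beauville, Variétés kählériennes dont la première classe de Chern est nulle,
  J. Differential Geom. 18 (1983), Thm. 5.
* [vanGeemen2000KugaSatakeHC] B. van Geemen, Kuga-Satake varieties and the Hodge conjecture (2000), §5.2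
  (arXiv math/9903146 p. 8 L23–27).
* [VoisinHodgeI2002] C. Voisin, Hodge Theory and Complex Algebraic Geometry I, §7.1.1, §7.3.1.
* [Floccari2024] S. Floccari, §5.1 (the presentation language).

## Provenance

Cell `hodge-nonav` (summit `HodgeConjecture`, rung F-H1), memo ROUTE-P3v20-g29-ADD1 §H1 (W2-HK); seat
`littype-FH1-2` (literature-prover, generation 18).
-/

noncomputable section

open Literature.AlgebraicTopology.SingularHomology

namespace Literature.AlgebraicGeometry.Hyperkaehler

open HodgeTheory
open Motives (SchemeOver IsSmoothProjective HodgeStructure)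

namespace Huybrechts1999_k3HilbertType_transcendentalPart_signature

section Reduction

variable {n : ℕ} {X : SchemeOver ℂ} {hX : IsSmoothProjective (2 * n) X}
  {M : HodgeModel (2 * n) X} {hM : M.IsHodgeSymmetric}
  {b : complexBetti X 2 →ₗ[ℂ] complexBetti X 2 →ₗ[ℂ] ℂ}
  {T : Type} [AddCommGroup T] [Module ℚ T] {H : HodgeStructure T 2} {P : H.Polarization}
  {j : H.Hom (bettiTwoHodgeStructureOfModel hX M hM)}

/-- **The Hodge pieces `T^{p,q}` of a presentation of the transcendental part vanish for `p < 0` or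
`q < 0`**: `j` is an injective morphism of Hodge structures into `H²_B(X)` (so `j_ℂ` is injective and maps
`T^{p,q}` into `H²_B(X)^{p,q}`, `Hom.map_piece_le`), and the pieces of the Hodge structure of a Hodge model
vanish off `0 ≤ p, q` (`F^r H² = 0` for `r > 2`, `HodgeModel.ratF_eq_bot`).
[cite: VoisinHodgeI2002, §7.1.1 and §7.3.1 Def. 7.22] [cite: Floccari2024, §5.1] -/
theorem piece_eq_bot_of_neg (hT : IsTranscendentalPartHK hX M hM b H P j) {p q : ℤ}
    (hpq : p < 0 ∨ q < 0) : H.piece p q = ⊥ := by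
  have hinj : Function.Injective (j.toLinearMap.baseChange ℂ) := by
    rw [LinearMap.baseChange_eq_ltensor]
    exact Module.Flat.lTensor_preserves_injective_linearMap _ hT.1
  -- the target piece vanishes
  have htarget : ∀ y, y ∈ (bettiTwoHodgeStructureOfModel hX M hM).piece p q → y = 0 := by
    intro y hy
    have hy' : y ∈ (M.hodgeStructure hX hM (2 * 1)).piece p q := by
      simpa only [HodgeStructure.cast_piece] using hy
    by_cases hPQ : p + q = ((2 * 1 : ℕ) : ℤ)
    · rw [HodgeStructure.mem_piece_iff _ hPQ, HodgeModel.hodgeStructure_F,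
        HodgeModel.hodgeStructure_F] at hy'
      rcases hpq with hP | hQ
      · rw [M.ratF_eq_bot hX (2 * 1) (show ((2 * 1 : ℕ) : ℤ) < q by omega), Submodule.mem_bot] at hy'
        have h2 := congrArg HodgeStructure.conj hy'.2
        rwa [HodgeStructure.conj_conj, map_zero] at h2
      · rw [M.ratF_eq_bot hX (2 * 1) (show ((2 * 1 : ℕ) : ℤ) < p by omega), Submodule.mem_bot] at hy'
        exact hy'.1
    · rw [HodgeStructure.piece_eq_bot_of_add_ne _ hPQ, Submodule.mem_bot] at hy'
      exact hy'
  rw [Submodule.eq_bot_iff]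
  intro x hx
  have h := htarget _ (j.map_piece_le p q ⟨x, hx, rfl⟩)
  exact hinj (by rw [h, map_zero])

/-- **The carrier `T` of a presentation of the transcendental part is finite-dimensional**: `j` embeds it
into `H²(X(ℂ); ℚ)`, finite-dimensional for the compact manifold `X(ℂ)`.
[cite: Floccari2024, §5.1] [cite: VoisinHodgeI2002, §7.1.1] -/
theorem finite_of_isTranscendentalPartHK (hT : IsTranscendentalPartHK hX M hM b H P j) :
    Module.Finite ℚ T := by
  letI := hX.chartedSpace
  haveI := Motives.ComplexPoints.compactSpace_of_isSmoothProjective hX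
  haveI := Motives.ComplexPoints.t2Space_of_isSmoothProjective hX
  haveI : Module.Finite ℚ (Motives.bettiCohomology X (2 * 1)) :=
    finite_singularCohomology_of_compact_chartedSpace ℚ ℚ (d := 2 * (2 * n)) (2 * 1)
  exact Module.Finite.of_injective j.toLinearMap hT.1

/-- **`h^{2,0}(T) = 1` makes a presentation of the transcendental part a Hodge structure of K3 type**
(`HodgeStructure.IsOfK3Type`: `h^{2,0} = 1` and `T^{p,q} = 0` for `|p - q| > 2`; the latter holds for
every presentation, `piece_eq_bot_of_neg`). [cite: Huybrechts2016K3, Def. 3.2.3] [cite: Floccari2024, §5.1] -/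
theorem isOfK3Type_of_hodgeNumber_two_zero (hT : IsTranscendentalPartHK hX M hM b H P j)
    (h20 : H.hodgeNumber 2 0 = 1) : H.IsOfK3Type := by
  refine ⟨h20, fun p q hpq => ?_⟩
  by_cases hsum : p + q = 2
  · refine piece_eq_bot_of_neg hT ?_
    rcases lt_abs.1 hpq with h | h
    · right; omega
    · left; omega
  · exact HodgeStructure.piece_eq_bot_of_add_ne _ hsum

end Reduction

/-- **REDUCTION of the named fact to its geometric kernel `h^{2,0}(T(X)) = 1`.** If every presentation
`(T, H, P, j)` of the transcendental part of a smooth projective `K3^[n]`-type `X` (`n ≥ 2`, any Fujiki form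
`b`, any Hodge-symmetric model) has `h^{2,0}(T) = 1` — Huybrechts 1999 §1.9: `H^{2,0}(X) = ℂσ` lies in
`T(X) ⊗ ℂ` because `q_X(σ, H^{1,1}) = 0` — then `Huybrechts1999_k3HilbertType_transcendentalPart_signature`
holds: `(T, H)` is then of K3 type (`isOfK3Type_of_hodgeNumber_two_zero`), `T` is finite-dimensional
(`finite_of_isTranscendentalPartHK`), and the signature theorem for polarizations of K3 type
(`Motives.HodgeStructure.Polarization.exists_basis_neg_form_of_isOfK3Type`: Hodge–Riemann II on
`T^{2,0} ⊕ T^{0,2}` and `T^{1,1}`, van Geemen 2000 §5.2) produces the orthogonal `ℚ`-basis with weights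
`w₀, w₁ > 0 > w₂, …`. The hypothesis is the only input of the fact not proved in the tree.
[cite: Huybrechts1999, §1.9 (arXiv p0004 L110 – p0005 L38)] [cite: vanGeemen2000KugaSatakeHC, §5.2 (arXiv p. 8 L23–27)] -/
theorem of_hodgeNumber_two_zero_eq_one
    (h20 : ∀ (n : ℕ), 2 ≤ n → ∀ ⦃X : SchemeOver ℂ⦄ (hX : IsSmoothProjective (2 * n) X), IsOfK3HilbertType n X →
      ∀ (b : complexBetti X 2 →ₗ[ℂ] complexBetti X 2 →ₗ[ℂ] ℂ), IsFujikiForm n X b →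
      ∀ (M : HodgeModel (2 * n) X) (hM : M.IsHodgeSymmetric)
        (T : Type) [AddCommGroup T] [Module ℚ T] (H : HodgeStructure T 2) (P : H.Polarization)
        (j : H.Hom (bettiTwoHodgeStructureOfModel hX M hM)),
        IsTranscendentalPartHK hX M hM b H P j → H.hodgeNumber 2 0 = 1) :
    Huybrechts1999_k3HilbertType_transcendentalPart_signature := by
  intro n hn X hX hK b hb M hM T _ _ H P j hT
  haveI : Module.Finite ℚ T := finite_of_isTranscendentalPartHK hT
  have hK3 : H.IsOfK3Type :=
    isOfK3Type_of_hodgeNumber_two_zero hT (h20 n hn hX hK b hb M hM T H P j hT)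
  exact P.exists_basis_neg_form_of_isOfK3Type H hK3

end Huybrechts1999_k3HilbertType_transcendentalPart_signature

end Literature.AlgebraicGeometry.Hyperkaehler

end
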